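import Summits.PneNP.PneNP.Theses.SzkEntropy
import Summits.PneNP.PneNP.Theorems.SzkEntropyPeaWorstToAvg
import Literature.Computability.Complexity.PolynomialEntropyApproximation
import Literature.Computability.Complexity.RandomizedProofs
import Literature.Computability.Complexity.BranchingFn

/-!
# PneNP / SzkEntropy — crux `PeaWorstToAvg` (stmt-PneNP-10777), negative side: the ∀-strengthening is
# false and one-sided ensembles are easy

Route `PneNP/SzkEntropy`, crux item stmt-PneNP-10777 (`PeaWorstToAvg`):

  `PEA 3 ∉ PromiseBPP' → ∃ D samplable, supported on the promise, with ((PEA 3).yes, D) ∉ HeurBPP`.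

Standing-disprover content (`Cruxes/PeaWorstToAvg/Disproof.lean`, §4), landed as negative knowledge.
The conclusion of the crux is an EXISTENTIAL over ensembles; this file shows, over the tree's
definitions and with no hypothesis, which ensembles can never witness it:

* `isPolySamplable_const` — point masses on a fixed string are polynomial-time samplable (coin-free
  constant sampler);
* `mem_HeurBPP_of_support_disjoint` / `mem_HeurBPP_of_support_subset` — an ensemble whose supports avoid
  `L` (resp. lie inside `L`) is `HeurBPP`-easy for `L` (constant scheme, no bad input on the support);
  hence for `PEA d`: ensembles of NO instances only, or of YES instances only, are easy
  (`pea_mem_HeurBPP_of_support_subset_no` / `_yes`), and a hard on-promise ensemble must charge BOTH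
  sides (`pea_exists_yes_and_no_of_not_mem_HeurBPP`);
* `szkEntropy_peaWorstToAvg_not_forall` — consequently the ∀-STRENGTHENING of the crux ("every
  samplable on-promise ensemble is hard") is FALSE outright: the point mass on the empty-map no-instance
  `⟨0, [], 0⟩` (`encode_peaEmptyInst_mem_no`) is samplable, on the promise and easy; and the crux's own
  hypothesis cannot rescue the ∀-version (`szkEntropy_peaWorstToAvg_not_forall_or`).

Reading for the crux: the ∃D must be a PLANTED, two-sided family of cubic maps; re-randomising one
worst-case map inside its entropy class (affine changes of variables, direct powers — entropy
invariants, `SzkEntropyPeaWorstToAvgOrbit.lean`) produces one-sided ensembles index by index and so,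
by itself, never a witness.

References: A. Bogdanov, L. Trevisan, *Average-Case Complexity* (2006), Def. 2.1, §2.3 and
Def. 2.12–2.13; Z. Dvir, D. Gutfreund, G. N. Rothblum, S. Vadhan, *On approximating the entropy of
polynomial mappings*, ICS 2011, §3 p. 6 and Claim 2.2; J. Gill, SIAM J. Comput. 6 (1977), Prop. 5.1.
-/

namespace Summit.PneNP.PneNP.Theorems

open Literature.Computability.Complexity Literature.Computability.MetaComplexity
open Summit.PneNP.PneNP.Theses.SzkEntropy
open _root_.Computability

/-! ### Constant samplers and constant schemes -/

/-- **Point masses on a fixed string are polynomial-time samplable** (the coin-free sampler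
`RandAlg.ofDet (fun _ => w)`; `RandAlg.IsPolyTime.ofDet_holds`, `const_mem_FP`).
[BogdanovTrevisan2006, Def. 2.1] -/
theorem isPolySamplable_const (w : List Bool) : Ensemble.IsPolySamplable fun _ => PMF.pure w := by
  have hc : PolyTimeComputable unaryEncodeNat (id : List Bool → List Bool) (fun _ : ℕ => w) :=
    PolyTimeComputable.of_encode_eq (f := fun _ : List Bool => w) unaryEncodeNat
      (fun _ => rfl) (fun _ => rfl) (const_mem_FP w)
  exact ⟨RandAlg.ofDet fun _ => w, RandAlg.IsPolyTime.ofDet_holds hc,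
    fun n => RandAlg.outputPMF_ofDet _ _ _⟩

/-- **An ensemble whose supports avoid `L` is `HeurBPP`-easy**: the constant-`false` scheme has no bad
input on any support (`mem_HeurBPP_of_randAlg_on_support`). [BogdanovTrevisan2006, §2.3] -/
theorem mem_HeurBPP_of_support_disjoint {L : Language Bool} (D : Ensemble)
    (h : ∀ n, ∀ x ∈ (D n).support, x ∉ L) : (⟨L, D⟩ : DistProblem) ∈ HeurBPP := by
  have hc : PolyTimeComputable (id : List Bool → List Bool) encodeBool (fun _ : List Bool => false) :=
    PolyTimeComputable.of_encode_eq (f := fun _ : List Bool => encodeBool false) id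
      (fun _ => rfl) (fun _ => rfl) (const_mem_FP (encodeBool false))
  refine mem_HeurBPP_of_randAlg_on_support D (RandAlg.ofDet fun _ => false)
    (RandAlg.IsPolyTime.ofDet_holds hc) ⟨0, fun n => by simp [RandAlg.ofDet]⟩ (fun _ _ => rfl)
    fun n x hx => ?_
  have hx : L.boolIndicator x = false := (L.notMem_iff_boolIndicator x).1 (h n x hx)
  rw [RandAlg.pr_ofDet]
  simp [hx]

/-- **An ensemble whose supports lie inside `L` is `HeurBPP`-easy** (constant-`true` scheme).
[BogdanovTrevisan2006, §2.3] -/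
theorem mem_HeurBPP_of_support_subset {L : Language Bool} (D : Ensemble)
    (h : ∀ n, ∀ x ∈ (D n).support, x ∈ L) : (⟨L, D⟩ : DistProblem) ∈ HeurBPP := by
  have hc : PolyTimeComputable (id : List Bool → List Bool) encodeBool (fun _ : List Bool => true) :=
    PolyTimeComputable.of_encode_eq (f := fun _ : List Bool => encodeBool true) id
      (fun _ => rfl) (fun _ => rfl) (const_mem_FP (encodeBool true))
  refine mem_HeurBPP_of_randAlg_on_support D (RandAlg.ofDet fun _ => true)
    (RandAlg.IsPolyTime.ofDet_holds hc) ⟨0, fun n => by simp [RandAlg.ofDet]⟩ (fun _ _ => rfl)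
    fun n x hx => ?_
  have hx : L.boolIndicator x = true := (L.mem_iff_boolIndicator x).1 (h n x hx)
  rw [RandAlg.pr_ofDet]
  simp [hx]

/-! ### One-sided on-promise ensembles of `PEA d` are easy -/

/-- **NO-side ensembles are easy**: an ensemble supported on NO instances of `PEA d` makes
`((PEA d).yes, D)` a member of `HeurBPP` (disjointness `PEA_disjoint`). [BogdanovTrevisan2006, §2.3;
DvirGutfreundRothblumVadhan2010, Def 3.1] -/
theorem pea_mem_HeurBPP_of_support_subset_no (d : ℕ) (D : Ensemble)
    (h : ∀ n, ∀ x ∈ (D n).support, x ∈ (PEA d).no) :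
    (⟨(PEA d).yes, D⟩ : DistProblem) ∈ HeurBPP :=
  mem_HeurBPP_of_support_disjoint D fun n x hx hy => Set.disjoint_left.1 (PEA_disjoint d) hy (h n x hx)

/-- **YES-side ensembles are easy.** [BogdanovTrevisan2006, §2.3] -/
theorem pea_mem_HeurBPP_of_support_subset_yes (d : ℕ) (D : Ensemble)
    (h : ∀ n, ∀ x ∈ (D n).support, x ∈ (PEA d).yes) :
    (⟨(PEA d).yes, D⟩ : DistProblem) ∈ HeurBPP :=
  mem_HeurBPP_of_support_subset D h

/-- **A hard on-promise ensemble charges both sides**: if `((PEA d).yes, D) ∉ HeurBPP` and `D` is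
supported on the promise, then some support contains a YES instance and some support contains a NO
instance. [BogdanovTrevisan2006, §2.3] -/
theorem pea_exists_yes_and_no_of_not_mem_HeurBPP (d : ℕ) {D : Ensemble}
    (hsupp : ∀ n : ℕ, ∀ w ∈ (D n).support, w ∈ (PEA d).yes ∨ w ∈ (PEA d).no)
    (hD : (⟨(PEA d).yes, D⟩ : DistProblem) ∉ HeurBPP) :
    (∃ n, ∃ w ∈ (D n).support, w ∈ (PEA d).yes) ∧ (∃ n, ∃ w ∈ (D n).support, w ∈ (PEA d).no) := by
  constructor
  · by_contra hno
    push Not at hno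
    refine hD (pea_mem_HeurBPP_of_support_subset_no d D fun n x hx => ?_)
    exact (hsupp n x hx).resolve_left (hno n x hx)
  · by_contra hyes
    push Not at hyes
    refine hD (pea_mem_HeurBPP_of_support_subset_yes d D fun n x hx => ?_)
    exact (hsupp n x hx).resolve_right (hyes n x hx)

/-! ### The ∀-strengthening of the crux is false -/

/-- **The empty map in `0` variables with threshold `0` is a NO instance of every `PEA d`**
(`H = 0 ≤ 0`, `PolyMapF2.entropy_nil`). [DvirGutfreundRothblumVadhan2010, Claim 2.2 and §3 p. 6] -/
theorem encode_peaEmptyInst_mem_no (d : ℕ) :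
    PEAInst.encoding.encode (⟨0, ([], 0)⟩ : PEAInst) ∈ (PEA d).no := by
  refine (encode_mem_PEA_no_iff d _).2 ⟨PolyMapF2.degLE_nil d, ?_⟩
  show PolyMapF2.entropy ([] : PolyMapF2 0) ≤ ((0 : ℕ) : ℝ)
  rw [PolyMapF2.entropy_nil]
  simp

/-- **The point mass on the empty no-instance is a samplable, on-promise, EASY ensemble** for every
`PEA d`. [BogdanovTrevisan2006, Def. 2.1 and §2.3] -/
theorem pea_noPointMass_props (d : ℕ) :
    Ensemble.IsPolySamplable (fun _ => PMF.pure (PEAInst.encoding.encode (⟨0, ([], 0)⟩ : PEAInst))) ∧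
      (∀ n : ℕ, ∀ w ∈ ((fun _ => PMF.pure (PEAInst.encoding.encode (⟨0, ([], 0)⟩ : PEAInst))) :
          Ensemble) n |>.support, w ∈ (PEA d).yes ∨ w ∈ (PEA d).no) ∧
      (⟨(PEA d).yes, fun _ => PMF.pure (PEAInst.encoding.encode (⟨0, ([], 0)⟩ : PEAInst))⟩ :
          DistProblem) ∈ HeurBPP := by
  have hsupp : ∀ (n : ℕ) (w : List Bool),
      w ∈ (((fun _ => PMF.pure (PEAInst.encoding.encode (⟨0, ([], 0)⟩ : PEAInst))) : Ensemble)
        n).support → w = PEAInst.encoding.encode (⟨0, ([], 0)⟩ : PEAInst) := by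
    intro n w hw
    simpa using hw
  refine ⟨isPolySamplable_const _, fun n w hw => Or.inr ?_, ?_⟩
  · rw [hsupp n w hw]
    exact encode_peaEmptyInst_mem_no d
  · exact pea_mem_HeurBPP_of_support_subset_no d _ fun n w hw =>
      hsupp n w hw ▸ encode_peaEmptyInst_mem_no d

/-- **The ∀-strengthening of `PeaWorstToAvg` is FALSE**: not every polynomial-time samplable
on-promise ensemble makes `((PEA 3).yes, D)` `HeurBPP`-hard (witness: the point mass on the empty
no-instance).  The crux's ∃D is essential and has to be constructed. [BogdanovTrevisan2006, §2.3] -/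
theorem szkEntropy_peaWorstToAvg_not_forall :
    ¬ ∀ D : Ensemble, D.IsPolySamplable →
        (∀ n : ℕ, ∀ w ∈ (D n).support, w ∈ (PEA 3).yes ∨ w ∈ (PEA 3).no) →
        (⟨(PEA 3).yes, D⟩ : DistProblem) ∉ HeurBPP := by
  intro h
  obtain ⟨hS, hsupp, hE⟩ := pea_noPointMass_props 3
  exact h _ hS hsupp hE

/-- **Nor does the crux's hypothesis rescue the ∀-version**: either the ∀-strengthening with the
antecedent `PEA 3 ∉ PromiseBPP'` in front is false, or the antecedent itself fails (kill switch).
[BogdanovTrevisan2006, §2.3] -/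
theorem szkEntropy_peaWorstToAvg_not_forall_or :
    ¬ (PEA 3 ∉ PromiseBPP' → ∀ D : Ensemble, D.IsPolySamplable →
        (∀ n : ℕ, ∀ w ∈ (D n).support, w ∈ (PEA 3).yes ∨ w ∈ (PEA 3).no) →
        (⟨(PEA 3).yes, D⟩ : DistProblem) ∉ HeurBPP) ∨ PEA 3 ∈ PromiseBPP' := by
  by_cases hB : PEA 3 ∈ PromiseBPP'
  · exact Or.inr hB
  · exact Or.inl fun h => szkEntropy_peaWorstToAvg_not_forall (h hB)

end Summit.PneNP.PneNP.Theorems
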